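import Mathlib
import Summits.NavierStokesRegularity.NavierStokesRegularity.Theorems.PowerGaugeEulerLiouville.Negative.RelaxingFlowFatVorticity

/-!
# Crux `EulerZoomLiouville.PowerGaugeEulerLiouville` (stmt-NavierStokesRegularity-19832) —
# the MASS–ENSTROPHY SLAVING INEQUALITY `∫|K₃ ∗ ω|² ≤ C (∫|ω|)^{4/3} (∫|ω|²)^{1/3}`

Negative-lane structure record (prover hand leafhand-ns-eulerzoomliouville-9 g0; `--supports` stmt-19832).  Pure kinematics on
`ℝ³`, the `L¹` twin of the volume-slaving inequality of the line `vortex-volume` (`CompactVortex.vortexVolumeEnergyIneq`,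
`∫|K₃ ∗ ω|² ≤ C · vol(supp ω)^{2/3} · ∫|ω|²`): with the interpolation `‖Φ‖_{6/5} ≤ ‖Φ‖₁^{2/3} ‖Φ‖₂^{1/3}` in place of Hölder on
the support,

  `‖(K₃ ∗ ω)(x)‖ ≤ (4π)⁻¹ I₁‖ω‖(x)` (tree `enorm_biotSavart_le_rieszPotential`),
  `‖I₁Φ‖₂ ≤ C_{HLS} ‖Φ‖_{6/5}` (tree `lintegral_rieszPotential_rpow_le'`, Stein's Hardy–Littlewood–Sobolev theorem, `n = 3`, `α = 1`,
  `p = 6/5`, `q = 2`),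

give

* `lintegral_rpow_sixFifths_le_mass_sq` — `∫ Φ^{6/5} ≤ (∫ Φ)^{4/5} (∫ Φ²)^{1/5}`;
* `vorticityMassEnergyIneq` — `∃ C, ∀ ω` continuous, `∫ ‖K₃ ∗ ω‖² ≤ C · (∫ ‖ω‖)^{4/3} · (∫ ‖ω‖²)^{1/3}`;
* `energy_le_vorticityMass_enstrophy` — for `C²` divergence-free `v` with `v, curl v ∈ L²`:
  `∫|v|² ≤ C · (∫|curl v|)^{4/3} · (∫|curl v|²)^{1/3}` (Biot–Savart representation `v = K₃ ∗ curl v`).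

Physical content for the door (F) of the crux (`…Negative.IntegrableVorticityNotRelaxing`): a finite-energy velocity whose vorticity
has BOUNDED MASS `∫|ω| ≤ W` has enstrophy `≥ (E/(C W^{4/3}))³` — energy cannot persist while the enstrophy relaxes unless the
vorticity mass blows up.  WHAT THIS IS NOT: not NS, not the crux, not a stub. [cite: Stein1971, Ch. V §1.2 Theorem 1 (b)]
-/

noncomputable section
set_option linter.dupNamespace false
namespace Summit.NavierStokesRegularity.NavierStokesRegularity.Theorems.PowerGaugeEulerLiouville.Negative

open MeasureTheory Set Function Filter Topology Metric Literature.Analysis Literature.Analysis.FluidPDE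
  Literature.Analysis.SingularIntegrals
open scoped NNReal ENNReal

/-! ## Part A — energy ≤ C · (vorticity mass)^{4/3} · (enstrophy)^{1/3} -/

/-- **Interpolation `‖Φ‖_{6/5} ≤ ‖Φ‖₁^{2/3} ‖Φ‖₂^{1/3}`** in the form `∫ Φ^{6/5} ≤ (∫ Φ)^{4/5} · (∫ Φ²)^{1/5}` for a measurable
size `Φ : ℝ³ → [0,∞]` (Hölder with exponents `(5/4, 5)` applied to `Φ^{4/5} · Φ^{2/5}`). [folklore] -/
theorem lintegral_rpow_sixFifths_le_mass_sq {Φ : EuclideanSpace ℝ (Fin 3) → ℝ≥0∞} (hΦ : Measurable Φ) :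
    ∫⁻ y, Φ y ^ (6 / 5 : ℝ) ≤ (∫⁻ y, Φ y) ^ (4 / 5 : ℝ) * (∫⁻ y, Φ y ^ (2 : ℝ)) ^ (1 / 5 : ℝ) := by
  have hpq : (5 / 4 : ℝ).HolderConjugate 5 := by rw [Real.holderConjugate_iff]; norm_num
  have hH := ENNReal.lintegral_mul_le_Lp_mul_Lq volume hpq
    (f := fun y => Φ y ^ (4 / 5 : ℝ)) (g := fun y => Φ y ^ (2 / 5 : ℝ))
    (hΦ.pow_const _).aemeasurable (hΦ.pow_const _).aemeasurable
  have hsplit : ∀ y, Φ y ^ (6 / 5 : ℝ) = Φ y ^ (4 / 5 : ℝ) * Φ y ^ (2 / 5 : ℝ) := fun y => by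
    rw [← ENNReal.rpow_add_of_nonneg _ _ (by norm_num) (by norm_num)]; norm_num
  have hf : ∀ y, (Φ y ^ (4 / 5 : ℝ)) ^ (5 / 4 : ℝ) = Φ y := fun y => by
    rw [← ENNReal.rpow_mul]; norm_num
  have hg : ∀ y, (Φ y ^ (2 / 5 : ℝ)) ^ (5 : ℝ) = Φ y ^ (2 : ℝ) := fun y => by
    rw [← ENNReal.rpow_mul]; norm_num
  simp only [Pi.mul_apply, hf, hg] at hH
  simp_rw [hsplit]
  refine hH.trans_eq ?_
  rw [show (1 / (5 / 4 : ℝ)) = 4 / 5 by norm_num, show (1 / (5 : ℝ)) = 1 / 5 by norm_num]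

/-- **THE MASS–ENSTROPHY SLAVING INEQUALITY for the Biot–Savart energy**: there is a universal `C` such that for every
continuous vorticity `ω : ℝ³ → ℝ³`,
`∫ ‖(K₃ ∗ ω)(x)‖² dx ≤ C · (∫ ‖ω‖)^{4/3} · (∫ ‖ω‖²)^{1/3}`
(`‖K₃ ∗ ω‖ ≤ (4π)⁻¹ I₁‖ω‖` pointwise, Hardy–Littlewood–Sobolev `‖I₁Φ‖₂ ≤ C_{HLS}‖Φ‖_{6/5}`, and
`lintegral_rpow_sixFifths_le_mass_sq`). Continuity is used only for measurability. [cite: Stein1971, Ch. V §1.2 Theorem 1 (b)] -/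
theorem vorticityMassEnergyIneq :
    ∃ C : ℝ≥0, ∀ ω : EuclideanSpace ℝ (Fin 3) → EuclideanSpace ℝ (Fin 3), Continuous ω →
      ∫⁻ x, ‖biotSavart ω x‖ₑ ^ 2 ≤
        (C : ℝ≥0∞) * (∫⁻ x, ‖ω x‖ₑ) ^ (4 / 3 : ℝ) * (∫⁻ x, ‖ω x‖ₑ ^ 2) ^ (1 / 3 : ℝ) := by
  -- the Hardy–Littlewood–Sobolev constant for `n = 3`, `α = 1`, `p = 6/5` (`q = 2`)
  obtain ⟨C, hC, hHLS⟩ := lintegral_rieszPotential_rpow_le' (μ := (volume : Measure (EuclideanSpace ℝ (Fin 3))))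
    (p := 6 / 5) (α := 1) (by norm_num) one_pos (by rw [finrank_real_euclideanSpace_fin_three]; norm_num)
  set c₀ : ℝ≥0∞ := ENNReal.ofReal (4 * Real.pi)⁻¹ with hc₀
  have hc₀t : c₀ ≠ ⊤ := ENNReal.ofReal_ne_top
  set K : ℝ≥0∞ := c₀ ^ 2 * C ^ (2 : ℝ) with hK
  have hKt : K ≠ ⊤ := ENNReal.mul_ne_top (ENNReal.pow_ne_top hc₀t) (ENNReal.rpow_ne_top_of_nonneg (by norm_num) hC.ne)
  refine ⟨K.toNNReal, fun ω hω => ?_⟩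
  rw [ENNReal.coe_toNNReal hKt]
  -- the size `Φ = ‖ω‖` and its Riesz potential
  set Φ : EuclideanSpace ℝ (Fin 3) → ℝ≥0∞ := fun y => (‖ω y‖ₑ : ℝ≥0∞) with hΦ
  have hΦm : Measurable Φ := hω.measurable.enorm
  set I : EuclideanSpace ℝ (Fin 3) → ℝ≥0∞ := rieszPotential volume 1 Φ with hI
  -- (1) pointwise domination
  have hpt : ∀ x, ‖biotSavart ω x‖ₑ ^ 2 ≤ c₀ ^ 2 * I x ^ (2 : ℝ) := by
    intro x
    have h := enorm_biotSavart_le_rieszPotential ω x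
    calc ‖biotSavart ω x‖ₑ ^ 2 ≤ (c₀ * I x) ^ 2 := pow_le_pow_left' h 2
      _ = c₀ ^ 2 * I x ^ (2 : ℝ) := by rw [mul_pow, ENNReal.rpow_two]
  -- (2) Hardy–Littlewood–Sobolev, squared: `∫ I² ≤ C² (∫ Φ^{6/5})^{5/3}`
  have hHLS' := hHLS Φ hΦm.aemeasurable
  rw [finrank_real_euclideanSpace_fin_three, show (3 : ℝ) * (6 / 5) / (3 - 1 * (6 / 5)) = 2 by norm_num] at hHLS'
  have h2 := ENNReal.rpow_le_rpow hHLS' (show (0 : ℝ) ≤ 2 by norm_num)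
  rw [← ENNReal.rpow_mul, show (1 / (2 : ℝ)) * 2 = 1 by norm_num, ENNReal.rpow_one,
    ENNReal.mul_rpow_of_nonneg _ _ (show (0 : ℝ) ≤ 2 by norm_num), ← ENNReal.rpow_mul,
    show (1 / (6 / 5 : ℝ)) * 2 = 5 / 3 by norm_num] at h2
  -- (3) interpolation: `(∫ Φ^{6/5})^{5/3} ≤ (∫ Φ)^{4/3} · (∫ Φ²)^{1/3}`
  have h3 : (∫⁻ y, Φ y ^ (6 / 5 : ℝ)) ^ (5 / 3 : ℝ) ≤
      (∫⁻ y, Φ y) ^ (4 / 3 : ℝ) * (∫⁻ y, Φ y ^ (2 : ℝ)) ^ (1 / 3 : ℝ) := by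
    have h := ENNReal.rpow_le_rpow (lintegral_rpow_sixFifths_le_mass_sq hΦm) (show (0 : ℝ) ≤ 5 / 3 by norm_num)
    rw [ENNReal.mul_rpow_of_nonneg _ _ (show (0 : ℝ) ≤ 5 / 3 by norm_num), ← ENNReal.rpow_mul, ← ENNReal.rpow_mul,
      show (4 / 5 : ℝ) * (5 / 3) = 4 / 3 by norm_num, show (1 / 5 : ℝ) * (5 / 3) = 1 / 3 by norm_num] at h
    exact h
  have hsq : ∀ y, Φ y ^ (2 : ℝ) = ‖ω y‖ₑ ^ 2 := fun y => by rw [hΦ, ENNReal.rpow_two]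
  simp_rw [hsq] at h3
  -- assemble
  calc ∫⁻ x, ‖biotSavart ω x‖ₑ ^ 2 ≤ ∫⁻ x, c₀ ^ 2 * I x ^ (2 : ℝ) := lintegral_mono hpt
    _ = c₀ ^ 2 * ∫⁻ x, I x ^ (2 : ℝ) := by
        rw [lintegral_const_mul' _ _ (ENNReal.pow_ne_top hc₀t)]
    _ ≤ c₀ ^ 2 * (C ^ (2 : ℝ) * (∫⁻ y, Φ y ^ (6 / 5 : ℝ)) ^ (5 / 3 : ℝ)) := by gcongr
    _ ≤ c₀ ^ 2 * (C ^ (2 : ℝ) * ((∫⁻ y, Φ y) ^ (4 / 3 : ℝ) * (∫⁻ y, ‖ω y‖ₑ ^ 2) ^ (1 / 3 : ℝ))) := by gcongr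
    _ = K * (∫⁻ x, ‖ω x‖ₑ) ^ (4 / 3 : ℝ) * (∫⁻ x, ‖ω x‖ₑ ^ 2) ^ (1 / 3 : ℝ) := by rw [hK]; ring

/-- **Energy is slaved to vorticity mass and enstrophy.**  With the constant of `vorticityMassEnergyIneq`: every `C²`
divergence-free field `v` on `ℝ³` with `∫|v|² < ∞` and `∫|curl v|² < ∞` satisfies
`∫|v|² ≤ C · (∫|curl v|)^{4/3} · (∫|curl v|²)^{1/3}` (Biot–Savart representation `v = K₃ ∗ curl v`,
`biotSavart_curl_eq_self_of_lintegral_sq_lt_top`). Vacuous but true when `curl v ∉ L¹`. [folklore] -/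
theorem energy_le_vorticityMass_enstrophy :
    ∃ C : ℝ≥0, ∀ v : EuclideanSpace ℝ (Fin 3) → EuclideanSpace ℝ (Fin 3), ContDiff ℝ 2 v →
      VectorCalculus.IsDivFree v → ∫⁻ x, ‖v x‖ₑ ^ 2 < ⊤ → ∫⁻ x, ‖curl v x‖ₑ ^ 2 < ⊤ →
      ∫⁻ x, ‖v x‖ₑ ^ 2 ≤
        (C : ℝ≥0∞) * (∫⁻ x, ‖curl v x‖ₑ) ^ (4 / 3 : ℝ) * (∫⁻ x, ‖curl v x‖ₑ ^ 2) ^ (1 / 3 : ℝ) := by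
  obtain ⟨C, hC⟩ := vorticityMassEnergyIneq
  refine ⟨C, fun v hv hdiv hv2 hω2 => ?_⟩
  have hωc : Continuous (curl v) := continuous_curl (hv.of_le (by norm_num))
  have h := hC (curl v) hωc
  rwa [biotSavart_curl_eq_self_of_lintegral_sq_lt_top hv hdiv hv2 hω2] at h


end Summit.NavierStokesRegularity.NavierStokesRegularity.Theorems.PowerGaugeEulerLiouville.Negative
end
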